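import Literature.LinearAlgebra.QuadraticForm.WittGroup
import HarnessLib

/-!
# Rank-one generators `⟨a⟩` of `W(K)`, the subgroup `I²(K)` of 2-fold Pfister classes, and the class of a
# quadratic form modulo `I²` through its dimension and discriminant

Topic `LinearAlgebra/QuadraticForm`; namespace `Literature.LinearAlgebra.QuadraticForm` (sequel of `WittGroup.lean`).
KERNEL mathematics only (definitions with bodies + theorems; no named fact, no `axiom`, no `sorry`).

[Knebusch2010, Ch. 1 §1.2] writes `W(K)` additively with `{φ} + {ψ} = {φ ⊥ ψ}`; every form over a field of
characteristic `≠ 2` is diagonalisable, `φ ≅ ⟨a₁, …, aₙ⟩`, so the classes `⟨a⟩` of the rank-one forms `a x²`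
generate `W(K)`.  [LionVergne1980, Appendix A.12–A.13] use, for the Weil character `γ` of a local field, the two
invariants "`rg Q`" and "`D(Q)` the discriminant" of a quadratic form `Q`; the present file isolates the purely
algebraic statement behind A.13/A.15 that is valid over ANY field of characteristic `≠ 2`:

* §1 `WittGroup.gen a = ⟨a⟩ := {a x²}`; `⟨a c²⟩ = ⟨a⟩`, `⟨−a⟩ = −⟨a⟩`, `⟨0⟩ = 0`; the class of a diagonal form
  `{⟨w₁, …, wₙ⟩} = Σ ⟨wᵢ⟩` (`wittClass_weightedSumSquares`), hence the `⟨a⟩` generate (`wittClass_eq_sum_gen`).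
* §2 the subgroup **`I²(K) ≤ W(K)`** ADDITIVELY GENERATED by the classes of the 2-fold Pfister forms
  `⟨⟨a, b⟩⟩ = ⟨1, −a, −b, ab⟩`, i.e. by `⟨1⟩ − ⟨a⟩ − ⟨b⟩ + ⟨ab⟩` (`a, b ≠ 0`).  (Once `W(K)` carries its ring structure this
  is the square of the fundamental ideal; only the additive subgroup is used here and below.)  The basic congruence
  `⟨a⟩ + ⟨b⟩ ≡ ⟨1⟩ + ⟨ab⟩ (mod I²)` and its iterate `Σᵢ ⟨wᵢ⟩ ≡ (n − 1)⟨1⟩ + ⟨∏ᵢ wᵢ⟩ (mod I²)`.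
* §3 **the class of a form modulo `I²` is read off from its dimension and discriminant**: for a quadratic form `Q`
  on a space with basis `b` (index type `ι`) whose Gram determinant `det (Q.toMatrix b)` is non-zero,
  `{Q} ≡ (|ι| − 1)·⟨1⟩ + ⟨det (Q.toMatrix b)⟩ (mod I²)` (`wittClass_sub_mem_I2`) — the discriminant is well defined
  modulo squares (`det` changes by the square of the base-change determinant), and `⟨·⟩` only sees square classes.

These are the inputs of `MaslovIndexDiscriminant.lean` (the dimension/discriminant of the Maslov index: the
Kashiwara–Witt index is a coboundary modulo `I²`, [LionVergne1980, §1.7.6, A.15]).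

## References

* [Knebusch2010] M. Knebusch, *Specialization of Quadratic and Symmetric Bilinear Forms*, Springer (2010), Ch. 1
  §1.2 (`W(K)`, diagonal forms).
* [LionVergne1980] G. Lion, M. Vergne, *The Weil representation, Maslov index and Theta series*, Birkhäuser
  (1980), Appendix A.12–A.13 (rank and discriminant of a quadratic form enter `γ`), A.15.
-/

set_option autoImplicit false

noncomputable section

open QuadraticMap Module Matrix

namespace Literature.LinearAlgebra.QuadraticForm

universe u v

variable {K : Type u} [Field K]

namespace WittGroup

/-! ## §1 Rank-one classes `⟨a⟩` -/

/-- **`⟨a⟩ ∈ W(K)`**: the Witt class of the rank-one form `a x²` on `K¹` (for `a = 0` this is the class `0` of the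
zero form). [cite: Knebusch2010, Ch. 1 §1.2] -/
def gen (a : K) : WittGroup K :=
  wittClass (weightedSumSquares K fun _ : Fin 1 => a)

/-- `⟨a⟩ = {a x²}` (unfolding). [cite: Knebusch2010, Ch. 1 §1.2] -/
theorem gen_def (a : K) : gen a = wittClass (weightedSumSquares K fun _ : Fin 1 => a) := rfl

/-- `⟨a c²⟩ = ⟨a⟩` for `c ≠ 0` (rescale the variable). [cite: Knebusch2010, Ch. 1 §1.2] -/
theorem gen_mul_mul_self (a : K) {c : K} (hc : c ≠ 0) : gen (a * c * c) = gen a := by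
  rw [gen, gen]
  refine (wittClass_eq_of_equivalent ⟨QuadraticForm.isometryEquivWeightedSumSquaresWeightedSumSquares
    (w := fun _ : Fin 1 => a) (w' := fun _ : Fin 1 => a * c * c) (fun _ => (Units.mk0 c hc)⁻¹) fun _ => ?_⟩).symm
  simp only [Units.val_inv_eq_inv_val, Units.val_mk0]
  field_simp

/-- `⟨a c²⟩ = ⟨a⟩` (square-class invariance, `c ≠ 0`). [cite: Knebusch2010, Ch. 1 §1.2] -/
theorem gen_mul_sq (a : K) {c : K} (hc : c ≠ 0) : gen (a * c ^ 2) = gen a := by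
  rw [pow_two, ← mul_assoc, gen_mul_mul_self a hc]

/-- `⟨c²⟩ = ⟨1⟩` for `c ≠ 0`. [cite: Knebusch2010, Ch. 1 §1.2] -/
theorem gen_sq {c : K} (hc : c ≠ 0) : gen (c ^ 2) = gen (1 : K) := by
  rw [← one_mul (c ^ 2), gen_mul_sq 1 hc]

/-- `⟨−a⟩ = −⟨a⟩` (`(−a) x² = −(a x²)`). [cite: Knebusch2010, Ch. 1 §1.2] -/
theorem gen_neg (a : K) : gen (-a) = -gen a := by
  rw [gen, gen, ← wittClass_neg]
  congr 1
  ext x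
  simp only [weightedSumSquares_apply, QuadraticMap.neg_apply, Finset.sum_neg_distrib, neg_smul]

/-- `⟨0⟩ = 0` (the zero form is split). [cite: Knebusch2010, Ch. 1 §1.2] -/
theorem gen_zero : gen (0 : K) = 0 := by
  rw [gen]
  have h : (weightedSumSquares K fun _ : Fin 1 => (0 : K)) = 0 := by
    ext x
    simp only [weightedSumSquares_apply, zero_smul, Finset.sum_const_zero, QuadraticMap.zero_apply]
  rw [h]
  exact hasLagrangian_zero.wittClass_eq_zero

/-- `K^{n+1} ≅ K¹ × Kⁿ`, `f ↦ (f 0, tail f)` (plumbing). [folklore] -/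
private def finSuccProd (n : ℕ) : (Fin (n + 1) → K) ≃ₗ[K] (Fin 1 → K) × (Fin n → K) where
  toFun f := (fun _ => f 0, Fin.tail f)
  invFun p := Fin.cons (p.1 0) p.2
  map_add' _ _ := rfl
  map_smul' _ _ := rfl
  left_inv f := Fin.cons_self_tail f
  right_inv p := Prod.ext (funext fun i => by
      change (Fin.cons (p.1 0) p.2 : Fin (n + 1) → K) 0 = p.1 i
      rw [Fin.cons_zero, Subsingleton.elim i 0])
    (funext fun i => Fin.cons_succ (α := fun _ => K) (p.1 0) p.2 i)

/-- `⟨w₀, w₁, …, wₙ⟩ ≅ ⟨w₀⟩ ⊥ ⟨w₁, …, wₙ⟩` (plumbing). [folklore] -/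
private def weightedSumSquaresSuccEquiv {n : ℕ} (w : Fin (n + 1) → K) :
    (weightedSumSquares K w).IsometryEquiv
      ((weightedSumSquares K fun _ : Fin 1 => w 0).prod (weightedSumSquares K (Fin.tail w))) where
  toLinearEquiv := finSuccProd n
  map_app' f := by
    change (weightedSumSquares K fun _ : Fin 1 => w 0) (fun _ => f 0) +
        weightedSumSquares K (Fin.tail w) (Fin.tail f) = weightedSumSquares K w f
    simp only [weightedSumSquares_apply, Finset.univ_unique, Fin.default_eq_zero, Finset.sum_singleton,
      Fin.sum_univ_succ, Fin.tail]

/-- **the class of a diagonal form is the sum of its rank-one classes**: `{⟨w₁, …, wₙ⟩} = Σᵢ ⟨wᵢ⟩`.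
[cite: Knebusch2010, Ch. 1 §1.2] -/
theorem wittClass_weightedSumSquares [NeZero (2 : K)] : ∀ {n : ℕ} (w : Fin n → K),
    wittClass (weightedSumSquares K w) = ∑ i, gen (w i)
  | 0, w => by
    rw [Finset.univ_eq_empty, Finset.sum_empty]
    have h : (weightedSumSquares K w) = 0 := by
      ext x
      simp only [weightedSumSquares_apply, Finset.univ_eq_empty, Finset.sum_empty, QuadraticMap.zero_apply]
    rw [h]
    exact hasLagrangian_zero.wittClass_eq_zero
  | n + 1, w => by
    rw [wittClass_eq_of_equivalent ⟨weightedSumSquaresSuccEquiv w⟩, wittClass_prod, Fin.sum_univ_succ,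
      wittClass_weightedSumSquares (Fin.tail w)]
    rfl

/-- **the rank-one classes generate `W(K)`** (characteristic `≠ 2`): every quadratic form on a finite-dimensional
space is diagonalisable, so `{Q} = Σᵢ ⟨Q(vᵢ)⟩` for an orthogonal basis `v`. [cite: Knebusch2010, Ch. 1 §1.2] -/
theorem wittClass_eq_sum_gen [NeZero (2 : K)] [Invertible (2 : K)] {V : Type v} [AddCommGroup V] [Module K V]
    [FiniteDimensional K V] (Q : QuadraticForm K V) :
    ∃ w : Fin (finrank K V) → K, wittClass Q = ∑ i, gen (w i) := by
  obtain ⟨w, hw⟩ := QuadraticForm.equivalent_weightedSumSquares Q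
  exact ⟨w, by rw [wittClass_eq_of_equivalent hw, wittClass_weightedSumSquares]⟩

/-- every Witt class is a sum of rank-one classes (characteristic `≠ 2`). [cite: Knebusch2010, Ch. 1 §1.2] -/
theorem exists_eq_sum_gen [NeZero (2 : K)] [Invertible (2 : K)] (x : WittGroup K) :
    ∃ (n : ℕ) (w : Fin n → K), x = ∑ i, gen (w i) := by
  obtain ⟨a, rfl⟩ := mk_surjective x
  obtain ⟨w, hw⟩ := wittClass_eq_sum_gen a.form
  exact ⟨_, w, by rw [← wittClass_form, hw]⟩

/-! ## §2 The subgroup `I²(K)` generated by the 2-fold Pfister classes -/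

section ISq

variable [NeZero (2 : K)]

variable (K) in
/-- **`I²(K) ≤ W(K)`**: the subgroup additively generated by the classes `⟨1⟩ − ⟨a⟩ − ⟨b⟩ + ⟨ab⟩` of the 2-fold
Pfister forms `⟨⟨a, b⟩⟩ = ⟨1, −a, −b, ab⟩`, `a, b ∈ Kˣ` (= the square of the fundamental ideal of the Witt RING;
only this additive description is used). [cite: Knebusch2010, Ch. 1 §1.2; LionVergne1980, Appendix A.13] -/
def I2 : AddSubgroup (WittGroup K) :=
  AddSubgroup.closure {x | ∃ a b : K, a ≠ 0 ∧ b ≠ 0 ∧ x = gen 1 - gen a - gen b + gen (a * b)}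

/-- the Pfister class `⟨1⟩ − ⟨a⟩ − ⟨b⟩ + ⟨ab⟩` lies in `I²`. [cite: Knebusch2010, Ch. 1 §1.2] -/
theorem pfister_mem_I2 {a b : K} (ha : a ≠ 0) (hb : b ≠ 0) :
    gen 1 - gen a - gen b + gen (a * b) ∈ I2 K :=
  AddSubgroup.subset_closure ⟨a, b, ha, hb, rfl⟩

/-- **`⟨a⟩ + ⟨b⟩ ≡ ⟨1⟩ + ⟨ab⟩ (mod I²)`** for `a, b ≠ 0`. [cite: Knebusch2010, Ch. 1 §1.2] -/
theorem gen_add_gen_sub_mem_I2 {a b : K} (ha : a ≠ 0) (hb : b ≠ 0) :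
    gen a + gen b - (gen 1 + gen (a * b)) ∈ I2 K := by
  have h := (I2 K).neg_mem (pfister_mem_I2 ha hb)
  convert h using 1
  abel

/-- **`Σᵢ ⟨wᵢ⟩ ≡ (n − 1)·⟨1⟩ + ⟨∏ᵢ wᵢ⟩ (mod I²)`** for non-zero `w₁, …, wₙ` (iterate the previous congruence;
for `n = 0` both sides vanish as `⟨1⟩ − ⟨1⟩`). [cite: Knebusch2010, Ch. 1 §1.2; LionVergne1980, Appendix A.13] -/
theorem sum_gen_sub_mem_I2 : ∀ {n : ℕ} (w : Fin n → K) (_hw : ∀ i, w i ≠ 0),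
    (∑ i, gen (w i)) - (((n : ℤ) - 1) • gen (1 : K) + gen (∏ i, w i)) ∈ I2 K
  | 0, w, _ => by
    simp only [Finset.univ_eq_empty, Finset.sum_empty, Finset.prod_empty, Nat.cast_zero, zero_sub, neg_smul,
      one_smul, neg_add_cancel, sub_zero]
    exact (I2 K).zero_mem
  | n + 1, w, hw => by
    have ih := sum_gen_sub_mem_I2 (Fin.tail w) fun i => hw i.succ
    have hP : (∏ i, Fin.tail w i) ≠ 0 := Finset.prod_ne_zero_iff.2 fun i _ => hw i.succ
    have h2 := gen_add_gen_sub_mem_I2 (hw 0) hP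
    have hsum := (I2 K).add_mem ih h2
    rw [Fin.sum_univ_succ, Fin.prod_univ_succ]
    convert hsum using 1
    simp only [Fin.tail, Nat.cast_add, Nat.cast_one]
    module

/-- `4·⟨1⟩ ∈ I²` (`⟨1, 1, 1, 1⟩ = ⟨⟨−1, −1⟩⟩`). [cite: Knebusch2010, Ch. 1 §1.2] -/
theorem four_smul_gen_one_mem_I2 : (4 : ℤ) • gen (1 : K) ∈ I2 K := by
  have h := pfister_mem_I2 (K := K) (a := -1) (b := -1) (neg_ne_zero.2 one_ne_zero) (neg_ne_zero.2 one_ne_zero)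
  rw [gen_neg, neg_mul_neg, one_mul] at h
  convert h using 1
  module

end ISq

/-! ## §3 The class of a form modulo `I²`: dimension and discriminant -/

section Discriminant

variable [Invertible (2 : K)]
variable {V : Type v} [AddCommGroup V] [Module K V]
variable {ι : Type*} [Fintype ι] [DecidableEq ι]

/-- the Gram matrix of `Q` in an orthogonal basis is the diagonal of the values `Q(vᵢ)` (plumbing). [folklore] -/
private theorem toMatrix_eq_diagonal_of_isOrthoᵢ (Q : QuadraticForm K V) (v : Basis ι K V)
    (hv : (QuadraticMap.associated (R := K) Q).IsOrthoᵢ v) :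
    Q.toMatrix v = Matrix.diagonal fun i => Q (v i) := by
  ext i j
  rw [QuadraticForm.toMatrix, LinearMap.toMatrix₂_apply]
  by_cases h : i = j
  · subst h
    rw [Matrix.diagonal_apply_eq]
    exact QuadraticMap.associated_eq_self_apply K Q (v i)
  · rw [Matrix.diagonal_apply_ne _ h]
    exact hv h

/-- **the discriminant changes by a square under a change of basis**: `det (Q.toMatrix b) = det (P)² · det (Q.toMatrix v)`
with `P` the base-change matrix (plumbing). [folklore] -/
private theorem det_toMatrix_basis_change (Q : QuadraticForm K V) (v b : Basis ι K V) :
    (Q.toMatrix b).det = (v.toMatrix b).det ^ 2 * (Q.toMatrix v).det := by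
  have h := LinearMap.toMatrix₂_mul_basis_toMatrix (b₁ := v) (b₂ := v) b b (QuadraticMap.associated (R := K) Q)
  change (v.toMatrix b)ᵀ * Q.toMatrix v * v.toMatrix b = Q.toMatrix b at h
  rw [← h, Matrix.det_mul, Matrix.det_mul, Matrix.det_transpose]
  ring

omit [Invertible (2 : K)] in
/-- the base-change matrix between two bases has non-zero determinant (plumbing). [folklore] -/
private theorem det_basis_toMatrix_ne_zero (v b : Basis ι K V) : (v.toMatrix b).det ≠ 0 := by
  have h := v.toMatrix_mul_toMatrix_flip b
  intro h0
  have := congrArg Matrix.det h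
  rw [Matrix.det_mul, h0, zero_mul, Matrix.det_one] at this
  exact zero_ne_one this

/-- **`{Q} ≡ (|ι| − 1)·⟨1⟩ + ⟨det (Q.toMatrix b)⟩ (mod I²)`** for any basis `b` in which the Gram determinant of `Q` is
non-zero: modulo `I²` the Witt class of a non-degenerate form is determined by its dimension and its discriminant
(diagonalise, `{Q} = Σ ⟨aᵢ⟩ ≡ (n−1)⟨1⟩ + ⟨∏ aᵢ⟩`, and `∏ aᵢ ≡ det` modulo squares).
[cite: Knebusch2010, Ch. 1 §1.2; LionVergne1980, Appendix A.13] -/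
theorem wittClass_sub_mem_I2 [NeZero (2 : K)] [FiniteDimensional K V] (Q : QuadraticForm K V)
    (b : Basis ι K V) (hd : (Q.toMatrix b).det ≠ 0) :
    wittClass Q - (((Fintype.card ι : ℤ) - 1) • gen (1 : K) + gen (Q.toMatrix b).det) ∈ I2 K := by
  classical
  -- an orthogonal basis, re-indexed by `ι`
  obtain ⟨v₀, hv₀⟩ :=
    LinearMap.BilinForm.exists_orthogonal_basis (QuadraticForm.associated_isSymm K Q)
  let e : ι ≃ Fin (finrank K V) := b.indexEquiv v₀
  let v : Basis ι K V := v₀.reindex e.symm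
  have hv : (QuadraticMap.associated (R := K) Q).IsOrthoᵢ v := by
    intro i j hij
    change QuadraticMap.associated (R := K) Q (v₀.reindex e.symm i) (v₀.reindex e.symm j) = 0
    rw [Basis.reindex_apply, Basis.reindex_apply, Equiv.symm_symm]
    exact hv₀ fun h => hij (e.injective h)
  -- the class: `{Q} = Σ ⟨Q(vᵢ)⟩`
  have hcls : wittClass Q = ∑ i, gen (Q (v i)) := by
    have hiso := QuadraticForm.isometryEquivWeightedSumSquares Q v₀ hv₀
    rw [wittClass_eq_of_equivalent ⟨hiso⟩, wittClass_weightedSumSquares]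
    refine Fintype.sum_equiv e.symm _ _ fun i => ?_
    change gen (Q (v₀ i)) = gen (Q (v₀.reindex e.symm (e.symm i)))
    rw [Basis.reindex_apply, Equiv.symm_symm, Equiv.apply_symm_apply]
  -- the discriminant: `det_b = det(P)² ∏ Q(vᵢ)`
  have hdet : (Q.toMatrix b).det = (v.toMatrix b).det ^ 2 * ∏ i, Q (v i) := by
    rw [det_toMatrix_basis_change Q v b, toMatrix_eq_diagonal_of_isOrthoᵢ Q v hv, Matrix.det_diagonal]
  have hP : (v.toMatrix b).det ≠ 0 := det_basis_toMatrix_ne_zero v b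
  have hprod : ∏ i, Q (v i) ≠ 0 := by
    intro h0
    rw [h0, mul_zero] at hdet
    exact hd hdet
  have hw : ∀ i, Q (v i) ≠ 0 := fun i h0 => hprod (Finset.prod_eq_zero (Finset.mem_univ i) h0)
  -- move to `Fin |ι|` and apply §2
  let f : ι ≃ Fin (Fintype.card ι) := Fintype.equivFin ι
  have hmem := sum_gen_sub_mem_I2 (K := K) (fun k => Q (v (f.symm k))) fun k => hw _
  have hs : ∑ k, gen (Q (v (f.symm k))) = ∑ i, gen (Q (v i)) := Fintype.sum_equiv f.symm _ _ fun _ => rfl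
  have hp : ∏ k, Q (v (f.symm k)) = ∏ i, Q (v i) := Fintype.prod_equiv f.symm _ _ fun _ => rfl
  rw [hs, hp] at hmem
  have hgen : gen (Q.toMatrix b).det = gen (∏ i, Q (v i)) := by
    rw [hdet, mul_comm ((v.toMatrix b).det ^ 2) (∏ i, Q (v i)), gen_mul_sq _ hP]
  rw [hcls, hgen]
  exact hmem

/-- the same congruence stated with `finrank`: `{Q} ≡ (dim V − 1)·⟨1⟩ + ⟨det (Q.toMatrix b)⟩ (mod I²)`.
[cite: Knebusch2010, Ch. 1 §1.2; LionVergne1980, Appendix A.13] -/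
theorem wittClass_sub_mem_I2' [NeZero (2 : K)] [FiniteDimensional K V] (Q : QuadraticForm K V)
    (b : Basis ι K V) (hd : (Q.toMatrix b).det ≠ 0) :
    wittClass Q - (((finrank K V : ℤ) - 1) • gen (1 : K) + gen (Q.toMatrix b).det) ∈ I2 K := by
  rw [finrank_eq_card_basis b]
  exact wittClass_sub_mem_I2 Q b hd

end Discriminant

end WittGroup

end Literature.LinearAlgebra.QuadraticForm
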